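import Mathlib
import Summits.Ventures.PercRepro2.TB14SlideKernels
import Summits.Ventures.PercRepro2.TB14CutSplit

/-!
# The equality locus of typed BHK 1.4: the root pair separates the two marks
(blind cell PercRepro2, mine-c g17, 2026-08-25; `proofs/MINEC-TB14BLOCK.md` Theorem J)

Let `X` be a set of vertices containing the mark `b` but not `o, a₁, a₂`, such that every edge
touching `X` has both ends in `X ∪ {a₁, a₂}` (`X` is a union of components of `G − {a₁, a₂}`).
Split the edges into `EA` (touching `X`) and `EB` (the rest).  A monochromatic `a₁–a₂` path uses
the edges of one part only, so `1_Q = 1_{Q_A} · 1_{Q_B}`; under `Q`, `b ∈ C_y(a₁)` is read on `EA`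
and `o ∈ C_y(a₂)` on `EB`.  Hence the folded kernel is a product `f(y_A, w_A) · g(y_B, w_B)`, the
product law of `TB14CutSplit` (on the auxiliary graph, as in `TB14PocketConn`) factorises the
two-copy count, and the `B`-factor is the antisymmetric spectator count `foldK0`, which vanishes.
So (`pairCount_foldK_rootSep`)

  `D(G; a₁, a₂, b, o) = 0`  whenever `b` and `o` lie in different components of `G − {a₁, a₂}`,

at every profile.  Census (`data/mine-c/g17/`): on every connected graph with ≤ 9 vertices, ALL
non-void ties of the all-free `(TB14)_sv` are of this kind (4,163,756 ties at n = 9, unexplained 0).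
Own work; standard axioms.
-/

namespace Summit.Ventures.PercRepro2

namespace TB14Cut

open CovForm A3InactiveTyped CutV

section RootSep

variable {V : Type} {E : Type} [Fintype E] [DecidableEq E] {R : Type*} [Field R]

/-! ## The product law for an edge partition (the auxiliary-graph witness of `TB14PocketConn`) -/

omit [Fintype E] [DecidableEq E] in
/-- `restrict` is idempotent. -/
lemma restrict_restrict (S : Set E) [DecidablePred (· ∈ S)] (y : Config E) :
    restrict S (restrict S y) = restrict S y := by
  funext e
  by_cases he : e ∈ S
  · rw [restrict_apply_of_mem he]
  · rw [restrict_apply_of_notMem he, restrict_apply_of_notMem he]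

/-- **Product law for an edge partition** (after `TB14PocketConn.pairCount_mul_of_parts`): a kernel
`f · g` with `f` read on `EA` and `g` on `EB` has two-copy count the product of the side counts. -/
theorem pairCount_mul_of_parts' {EA EB : Set E} [DecidablePred (· ∈ EA)] [DecidablePred (· ∈ EB)]
    (hcover : ∀ e, e ∈ EA ∨ e ∈ EB) (hdisj : Disjoint EA EB)
    (F : Finset E) (z : Config E) (f g : Config E → Config E → R)
    (hf : ∀ y w, f y w = f (restrict EA y) (restrict EA w))
    (hg : ∀ y w, g y w = g (restrict EB y) (restrict EB w)) :
    pairCount F z (fun y w => f y w * g y w) =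
      pairCount (sideFree EA F) (restrict EA z) f * pairCount (sideFree EB F) (restrict EB z) g := by
  let ends₀ : E → Sym2 (Option Bool) := fun e =>
    if e ∈ EA then s(some true, some true) else s(some false, some false)
  have hcut : IsCut ends₀ none {some true} {some false} EA EB :=
    { disj := by simp
      x_notA := by simp
      x_notB := by simp
      EA_sub := by
        intro e he
        refine ⟨some true, Or.inl rfl, some true, Or.inl rfl, ?_⟩
        simp [ends₀, he]
      EB_sub := by
        intro e he
        have : e ∉ EA := fun h => Set.disjoint_left.1 hdisj h he
        refine ⟨some false, Or.inl rfl, some false, Or.inl rfl, ?_⟩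
        simp [ends₀, this]
      cover := hcover
      Edisj := hdisj }
  exact pairCount_mul_of_cut hcut F z f g hf hg

/-! ## Connections across the root pair -/

variable {ends : E → Sym2 V} {a₁ a₂ : V} {X : Set V}

/-- The edges touching `X`. -/
def touchX (ends : E → Sym2 V) (X : Set V) : Set E := {e | ∃ v ∈ X, v ∈ ends e}

omit [Fintype E] [DecidableEq E] in
/-- The restriction of a configuration to a part is dominated by the configuration. -/
lemma restrict_le (S : Set E) [DecidablePred (· ∈ S)] (y : Config E) : restrict S y ≤ y := by
  intro e
  by_cases he : e ∈ S
  · rw [restrict_apply_of_mem he]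
  · rw [restrict_apply_of_notMem he]; exact Bool.false_le _

omit [Fintype E] [DecidableEq E] in
/-- An open edge of `y` is open in the restriction to the part containing it. -/
lemma open_restrict_of_mem {S : Set E} [DecidablePred (· ∈ S)] {y : Config E} {e : E}
    (he : e ∈ S) (hy : y e = true) : restrict S y e = true := by
  rw [restrict_apply_of_mem he]; exact hy

omit [Fintype E] [DecidableEq E] in
/-- An open edge of `y` which does not touch `X` is open in the `B`-restriction. -/
lemma open_restrictB {y : Config E} {e : E} [DecidablePred (· ∈ (touchX ends X)ᶜ)]
    (he : e ∉ touchX ends X) (hy : y e = true) : restrict (touchX ends X)ᶜ y e = true :=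
  open_restrict_of_mem (S := (touchX ends X)ᶜ) he hy

section Paths

omit [Fintype E] [DecidableEq E] in
/-- The ends of an edge touching `X` lie in `X ∪ {a₁, a₂}`. -/
lemma ends_of_touch (hX : ∀ e, ∀ v ∈ ends e, v ∈ X → ∀ v' ∈ ends e, v' ∈ X ∨ v' = a₁ ∨ v' = a₂)
    {e : E} (he : e ∈ touchX ends X) {v : V} (hv : v ∈ ends e) :
    v ∈ X ∨ v = a₁ ∨ v = a₂ := by
  obtain ⟨u, huX, hu⟩ := he
  exact hX e u hu huX v hv

variable [DecidablePred (· ∈ touchX ends X)] [DecidablePred (· ∈ (touchX ends X)ᶜ)]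
variable (hX : ∀ e, ∀ v ∈ ends e, v ∈ X → ∀ v' ∈ ends e, v' ∈ X ∨ v' = a₁ ∨ v' = a₂)
  (ha₁ : a₁ ∉ X) (ha₂ : a₂ ∉ X) (h12 : a₁ ≠ a₂)
include hX ha₁ ha₂ h12

omit [Fintype E] [DecidableEq E] in
/-- **(L1)** A monochromatic `a₁–a₂` path uses the edges of one part only. -/
lemma conn_roots_split (y : Config E) :
    Conn ends y a₁ a₂ ↔
      Conn ends (restrict (touchX ends X) y) a₁ a₂ ∨ Conn ends (restrict (touchX ends X)ᶜ y) a₁ a₂ := by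
  set yA := restrict (touchX ends X) y with hyA
  set yB := restrict (touchX ends X)ᶜ y with hyB
  constructor
  · intro hc
    have key : a₂ ∈ {t | (Conn ends yA a₁ a₂ ∨ Conn ends yB a₁ a₂) ∨ t = a₁ ∨
        (t ∈ X ∧ Conn ends yA a₁ t) ∨ (t ∉ X ∧ t ≠ a₂ ∧ Conn ends yB a₁ t)} := by
      refine mem_of_conn_of_closed (S := {t | (Conn ends yA a₁ a₂ ∨ Conn ends yB a₁ a₂) ∨ t = a₁ ∨
        (t ∈ X ∧ Conn ends yA a₁ t) ∨ (t ∉ X ∧ t ≠ a₂ ∧ Conn ends yB a₁ t)}) ?_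
        (Or.inr (Or.inl rfl)) hc
      intro s hs s' hss'
      obtain ⟨_, f, hf, hends⟩ := openGraph_adj.1 hss'
      have hs_mem : s ∈ ends f := by rw [hends]; exact Sym2.mem_mk_left _ _
      have hs'_mem : s' ∈ ends f := by rw [hends]; exact Sym2.mem_mk_right _ _
      rcases hs with hglob | hs | ⟨hsX, hsA⟩ | ⟨hsX, hs2, hsB⟩
      · exact Or.inl hglob
      · -- `s = a₁`
        subst hs
        by_cases hfA : f ∈ touchX ends X
        · have hfo : yA f = true := open_restrict_of_mem hfA hf
          have hcs' : Conn ends yA s s' := conn_of_openAdj ⟨f, hfo, hends⟩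
          rcases ends_of_touch hX hfA hs'_mem with h | h | h
          · exact Or.inr (Or.inr (Or.inl ⟨h, hcs'⟩))
          · exact Or.inr (Or.inl h)
          · subst h; exact Or.inl (Or.inl hcs')
        · have hfo : yB f = true := open_restrictB hfA hf
          have hcs' : Conn ends yB s s' := conn_of_openAdj ⟨f, hfo, hends⟩
          have hs'X : s' ∉ X := fun h => hfA ⟨s', h, hs'_mem⟩
          by_cases h2 : s' = a₂
          · subst h2; exact Or.inl (Or.inr hcs')
          · exact Or.inr (Or.inr (Or.inr ⟨hs'X, h2, hcs'⟩))
      · -- `s ∈ X`, reached inside `EA`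
        have hfA : f ∈ touchX ends X := ⟨s, hsX, hs_mem⟩
        have hfo : yA f = true := open_restrict_of_mem hfA hf
        have hcs' : Conn ends yA a₁ s' := conn_trans hsA (conn_of_openAdj ⟨f, hfo, hends⟩)
        rcases ends_of_touch hX hfA hs'_mem with h | h | h
        · exact Or.inr (Or.inr (Or.inl ⟨h, hcs'⟩))
        · exact Or.inr (Or.inl h)
        · subst h; exact Or.inl (Or.inl hcs')
      · -- `s ∉ X`, `s ≠ a₂`, reached inside `EB`
        by_cases hfA : f ∈ touchX ends X
        · rcases ends_of_touch hX hfA hs_mem with h | h | h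
          · exact absurd h hsX
          · subst h
            have hfo : yA f = true := open_restrict_of_mem hfA hf
            have hcs' : Conn ends yA s s' := conn_of_openAdj ⟨f, hfo, hends⟩
            rcases ends_of_touch hX hfA hs'_mem with h' | h' | h'
            · exact Or.inr (Or.inr (Or.inl ⟨h', hcs'⟩))
            · exact Or.inr (Or.inl h')
            · subst h'; exact Or.inl (Or.inl hcs')
          · exact absurd h hs2
        · have hfo : yB f = true := open_restrictB hfA hf
          have hcs' : Conn ends yB a₁ s' := conn_trans hsB (conn_of_openAdj ⟨f, hfo, hends⟩)
          have hs'X : s' ∉ X := fun h => hfA ⟨s', h, hs'_mem⟩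
          by_cases h2 : s' = a₂
          · subst h2; exact Or.inl (Or.inr hcs')
          · exact Or.inr (Or.inr (Or.inr ⟨hs'X, h2, hcs'⟩))
    rcases key with hk | hk | ⟨hk, _⟩ | ⟨_, hk, _⟩
    · exact hk
    · exact absurd hk.symm h12
    · exact absurd hk ha₂
    · exact absurd rfl hk
  · rintro (hc | hc)
    · exact conn_mono (restrict_le _ y) hc
    · exact conn_mono (restrict_le _ y) hc

omit [Fintype E] [DecidableEq E] in
/-- **(L2)** Under `Q`, a connection from `a₁` to a vertex of `X` lives in `EA`. -/
lemma conn_a₁_inX {y : Config E} (hQ : ¬ Conn ends y a₁ a₂) {b : V} (hb : b ∈ X) :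
    Conn ends y a₁ b ↔ Conn ends (restrict (touchX ends X) y) a₁ b := by
  set yA := restrict (touchX ends X) y with hyA
  set yB := restrict (touchX ends X)ᶜ y with hyB
  constructor
  · intro hc
    have key : b ∈ {t | (t ∈ X ∧ Conn ends yA a₁ t) ∨ (t ∉ X ∧ Conn ends yB a₁ t)} := by
      refine mem_of_conn_of_closed
        (S := {t | (t ∈ X ∧ Conn ends yA a₁ t) ∨ (t ∉ X ∧ Conn ends yB a₁ t)}) ?_
        (Or.inr ⟨ha₁, conn_refl _ _ _⟩) hc
      intro s hs s' hss'
      obtain ⟨_, f, hf, hends⟩ := openGraph_adj.1 hss'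
      have hs_mem : s ∈ ends f := by rw [hends]; exact Sym2.mem_mk_left _ _
      have hs'_mem : s' ∈ ends f := by rw [hends]; exact Sym2.mem_mk_right _ _
      have hQ' : s' ≠ a₂ := fun h => by
        subst h
        have hys : Conn ends y a₁ s := by
          rcases hs with ⟨_, h⟩ | ⟨_, h⟩
          · exact conn_mono (restrict_le _ y) h
          · exact conn_mono (restrict_le _ y) h
        exact hQ (conn_trans hys (conn_of_openAdj ⟨f, hf, hends⟩))
      rcases hs with ⟨hsX, hsA⟩ | ⟨hsX, hsB⟩
      · have hfA : f ∈ touchX ends X := ⟨s, hsX, hs_mem⟩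
        have hfo : yA f = true := open_restrict_of_mem hfA hf
        have hcs' : Conn ends yA a₁ s' := conn_trans hsA (conn_of_openAdj ⟨f, hfo, hends⟩)
        rcases ends_of_touch hX hfA hs'_mem with h | h | h
        · exact Or.inl ⟨h, hcs'⟩
        · subst h; exact Or.inr ⟨ha₁, conn_refl _ _ _⟩
        · exact absurd h hQ'
      · by_cases hfA : f ∈ touchX ends X
        · rcases ends_of_touch hX hfA hs_mem with h | h | h
          · exact absurd h hsX
          · subst h
            have hfo : yA f = true := open_restrict_of_mem hfA hf
            have hcs' : Conn ends yA s s' := conn_of_openAdj ⟨f, hfo, hends⟩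
            rcases ends_of_touch hX hfA hs'_mem with h' | h' | h'
            · exact Or.inl ⟨h', hcs'⟩
            · subst h'; exact Or.inr ⟨ha₁, conn_refl _ _ _⟩
            · exact absurd h' hQ'
          · subst h
            exact absurd (conn_mono (restrict_le _ y) hsB) (fun h => hQ h)
        · have hfo : yB f = true := open_restrictB hfA hf
          have hs'X : s' ∉ X := fun h => hfA ⟨s', h, hs'_mem⟩
          exact Or.inr ⟨hs'X, conn_trans hsB (conn_of_openAdj ⟨f, hfo, hends⟩)⟩
    rcases key with ⟨_, hk⟩ | ⟨hk, _⟩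
    · exact hk
    · exact absurd hb hk
  · exact conn_mono (restrict_le _ y)

omit [Fintype E] [DecidableEq E] in
/-- **(L3)** Under `Q`, a connection from `a₂` to a vertex outside `X` lives in `EB`. -/
lemma conn_a₂_outX {y : Config E} (hQ : ¬ Conn ends y a₁ a₂) {o : V} (ho : o ∉ X) :
    Conn ends y a₂ o ↔ Conn ends (restrict (touchX ends X)ᶜ y) a₂ o := by
  set yA := restrict (touchX ends X) y with hyA
  set yB := restrict (touchX ends X)ᶜ y with hyB
  constructor
  · intro hc
    have key : o ∈ {t | (t ∈ X ∧ Conn ends yA a₂ t) ∨ (t ∉ X ∧ Conn ends yB a₂ t)} := by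
      refine mem_of_conn_of_closed
        (S := {t | (t ∈ X ∧ Conn ends yA a₂ t) ∨ (t ∉ X ∧ Conn ends yB a₂ t)}) ?_
        (Or.inr ⟨ha₂, conn_refl _ _ _⟩) hc
      intro s hs s' hss'
      obtain ⟨_, f, hf, hends⟩ := openGraph_adj.1 hss'
      have hs_mem : s ∈ ends f := by rw [hends]; exact Sym2.mem_mk_left _ _
      have hs'_mem : s' ∈ ends f := by rw [hends]; exact Sym2.mem_mk_right _ _
      have hQ' : s' ≠ a₁ := fun h => by
        subst h
        have hys : Conn ends y a₂ s := by
          rcases hs with ⟨_, h⟩ | ⟨_, h⟩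
          · exact conn_mono (restrict_le _ y) h
          · exact conn_mono (restrict_le _ y) h
        exact hQ (conn_symm (conn_trans hys (conn_of_openAdj ⟨f, hf, hends⟩)))
      rcases hs with ⟨hsX, hsA⟩ | ⟨hsX, hsB⟩
      · have hfA : f ∈ touchX ends X := ⟨s, hsX, hs_mem⟩
        have hfo : yA f = true := open_restrict_of_mem hfA hf
        have hcs' : Conn ends yA a₂ s' := conn_trans hsA (conn_of_openAdj ⟨f, hfo, hends⟩)
        rcases ends_of_touch hX hfA hs'_mem with h | h | h
        · exact Or.inl ⟨h, hcs'⟩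
        · exact absurd h hQ'
        · subst h; exact Or.inr ⟨ha₂, conn_refl _ _ _⟩
      · by_cases hfA : f ∈ touchX ends X
        · rcases ends_of_touch hX hfA hs_mem with h | h | h
          · exact absurd h hsX
          · subst h
            exact absurd (conn_symm (conn_mono (restrict_le _ y) hsB)) (fun h => hQ h)
          · subst h
            have hfo : yA f = true := open_restrict_of_mem hfA hf
            have hcs' : Conn ends yA s s' := conn_of_openAdj ⟨f, hfo, hends⟩
            rcases ends_of_touch hX hfA hs'_mem with h' | h' | h'
            · exact Or.inl ⟨h', hcs'⟩
            · exact absurd h' hQ'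
            · subst h'; exact Or.inr ⟨ha₂, conn_refl _ _ _⟩
        · have hfo : yB f = true := open_restrictB hfA hf
          have hs'X : s' ∉ X := fun h => hfA ⟨s', h, hs'_mem⟩
          exact Or.inr ⟨hs'X, conn_trans hsB (conn_of_openAdj ⟨f, hfo, hends⟩)⟩
    rcases key with ⟨hk, _⟩ | ⟨_, hk⟩
    · exact absurd hk ho
    · exact hk
  · exact conn_mono (restrict_le _ y)

end Paths

/-! ## The theorem -/

/-- **The root pair separates the marks ⟹ the typed BHK 1.4 slack vanishes** (THEOREM J): if
`X ∋ b` is a union of components of `G − {a₁, a₂}` not containing `o`, then at every profile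
`pairCount F z (foldK ends a₁ a₂ b o) = 0`. -/
theorem pairCount_foldK_rootSep {b o : V}
    (hX : ∀ e, ∀ v ∈ ends e, v ∈ X → ∀ v' ∈ ends e, v' ∈ X ∨ v' = a₁ ∨ v' = a₂)
    (ha₁ : a₁ ∉ X) (ha₂ : a₂ ∉ X) (h12 : a₁ ≠ a₂) (hb : b ∈ X) (ho : o ∉ X)
    (F : Finset E) (z : Config E) :
    pairCount F z (foldK ends a₁ a₂ b o : Config E → Config E → R) = 0 := by
  classical
  set EA := touchX ends X with hEA
  set EB := (touchX ends X)ᶜ with hEB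
  -- the two side kernels
  set f : Config E → Config E → R := fun y w =>
    iQ ends a₁ a₂ (restrict EA y) * iQ ends a₁ a₂ (restrict EA w) * iL ends a₁ b (restrict EA y)
    with hf
  set g : Config E → Config E → R := fun y w => foldK0 ends a₁ a₂ o (restrict EB y) (restrict EB w)
    with hg
  -- pointwise factorisation
  have hpt : ∀ y w : Config E, (foldK ends a₁ a₂ b o y w : R) = f y w * g y w := by
    intro y w
    simp only [foldK, foldK0, hf, hg, iQ_eq_ite', iL_eq_ite', iH_eq_ite']
    rw [conn_roots_split hX ha₁ ha₂ h12 y, conn_roots_split hX ha₁ ha₂ h12 w]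
    by_cases hQy : Conn ends y a₁ a₂
    · rw [conn_roots_split hX ha₁ ha₂ h12 y] at hQy
      rcases hQy with h | h
      · rw [if_pos (Or.inl h), if_pos h]; ring
      · rw [if_pos (Or.inr h), if_pos h]; ring
    · have hQy' := hQy
      rw [conn_roots_split hX ha₁ ha₂ h12 y, not_or] at hQy'
      rw [if_neg (not_or.2 hQy'), if_neg hQy'.1, if_neg hQy'.2,
        conn_a₁_inX hX ha₁ ha₂ h12 hQy hb, conn_a₂_outX hX ha₁ ha₂ h12 hQy ho]
      by_cases hQw : Conn ends w a₁ a₂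
      · rw [conn_roots_split hX ha₁ ha₂ h12 w] at hQw
        rcases hQw with h | h
        · rw [if_pos (Or.inl h), if_pos h]; ring
        · rw [if_pos (Or.inr h), if_pos h]; ring
      · have hQw' := hQw
        rw [conn_roots_split hX ha₁ ha₂ h12 w, not_or] at hQw'
        rw [if_neg (not_or.2 hQw'), if_neg hQw'.1, if_neg hQw'.2,
          conn_a₂_outX hX ha₁ ha₂ h12 hQw ho]
        ring
  have hfr : ∀ y w, f y w = f (restrict EA y) (restrict EA w) := by
    intro y w; simp only [hf, restrict_restrict]
  have hgr : ∀ y w, g y w = g (restrict EB y) (restrict EB w) := by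
    intro y w; simp only [hg, restrict_restrict]
  have hcover : ∀ e, e ∈ EA ∨ e ∈ EB := fun e => by
    by_cases h : e ∈ EA
    · exact Or.inl h
    · exact Or.inr h
  have hdisj : Disjoint EA EB := disjoint_compl_right
  have hprod : pairCount F z (fun y w => f y w * g y w) =
      pairCount (sideFree EA F) (restrict EA z) f * pairCount (sideFree EB F) (restrict EB z) g :=
    pairCount_mul_of_parts' hcover hdisj F z f g hfr hgr
  have hfold : (foldK ends a₁ a₂ b o : Config E → Config E → R) = fun y w => f y w * g y w := by
    funext y w; exact hpt y w
  rw [hfold, hprod]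
  have hg0 : pairCount (sideFree EB F) (restrict EB z) g = 0 := by
    refine pairCount_eq_zero_of_antisymm _ _ g ?_ ?_
    · intro y w; simp only [hg]; exact foldK0_swap _ _ _ _ _ _
    · intro y; simp only [hg]; exact foldK0_diag _ _ _ _ _
  rw [hg0, mul_zero]

end RootSep

end TB14Cut

end Summit.Ventures.PercRepro2
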